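import Summits.NavierStokesRegularity.NavierStokesRegularity.Theses.AxisymmetricExtremality
import Literature.Analysis.FluidPDE.Seregin2020AxisymmetricTypeII
import Literature.Analysis.FluidPDE.SereginSverakBlowupSelection
import Literature.Analysis.FluidPDE.SqIntegralBalance
import HarnessLib

/-!
# Seregin 2020, Lemma 2.2 (after Nazarov–Uraltseva 2012), piece L22-C: one step of the chain of
# cylinders (N–U Cor 3.2 (2)) from the three analytic atoms, and two measure-theoretic tools

Helper toward the stub `stub_seregin2020TypeII` of the crux `AxisymmetricKatoGlobal` (= the named
fact `Literature.Analysis.FluidPDE.Seregin2020_axisymmetricSingularPoint_typeII`, G. Seregin,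
Anal. Math. Phys. 10 (2020) Paper 46 = arXiv:2006.04140, Thm 2.1). The only missing ingredient
in the tree is Lemma 2.2 in the corrected rendering `hWH′` (hypothesis of
`blowupIndex_eq_top_of_weakHarnack'`), i.e. Nazarov–Uraltseva's Lemma 4.2 in Seregin's class 𝒱.
Piece L22-C (cell pub/ns-inputs, seat ns-in-ser-c; skeleton
`Cruxes/AxisymmetricKatoGlobal/Seregin2020Lemma22ExpansionOfPositivity.lean`) is N–U's Cor 3.3
«expansion of positivity», composed from three analytic atoms — L3.1′ (Moser local maximum
estimate + Cor 3.1 (2) + Remark 6), L3.2′ (propagation of density), L3.3′ (De Giorgi shrinking) —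
which are separate files. THIS file proves the purely combinatorial layers, with the atoms
(specialised to the data) as written-out hypotheses:

* `ae_ball_le_of_ae_cylinder_le` — «a.e. on an open cylinder ⇒ a.e. on every later time slice
  up to the top»: the substitute for N–U's Lipschitz continuity, from the continuity of `Φ` off
  the closed axis set `S` (class 𝒱);
* `exists_mem_Ioo_lt_volume_slice` — a space–time set of large measure has a time slice of large
  measure (Tonelli), used to select N–U's `t̄`;
* `chain_step` — N–U Cor 3.2 (2): a full-ball lower bound `Φ(t_b, ·) ≥ κ` on `B(r)` propagates to
  `Φ ≥ 2^{-(s+1)}κ/3` a.e. on `]t_b, t_b + θr²[ × B(r')`, `r/r' ∈ [λlo, 2]` (L3.2′ with `δ₀ = 1`,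
  L3.3′ with `λ = 2`, `δ₁ = 1/3`, L3.1′ (ii));
(The iteration along N–U's chain of cylinders, Lemma 3.4, is the sibling `…Lemma22ExpansionChain`.)

No Navier–Stokes statement is touched; the drift, the axis and the singular set enter only through
the atoms (energy-class formulation, see the skeleton).

## References

* A. I. Nazarov, N. N. Uraltseva, St. Petersburg Math. J. 23 (2012) 93–115 = arXiv:1011.1888,
  §3: Cor 3.2, Lemma 3.4 (and Lemmas 3.1–3.3, Remarks 6, 9). [NazarovUraltseva2012]
* G. Seregin, Anal. Math. Phys. 10 (2020), Paper 46 = arXiv:2006.04140, Lemma 2.2. [Seregin2020]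
-/

-- the problem directory repeats the summit name (D-0017); core's `dupNamespace` linter fires
set_option linter.dupNamespace false

noncomputable section

open MeasureTheory Set Function Filter Topology TopologicalSpace Metric
open scoped NNReal ENNReal

namespace Summit.NavierStokesRegularity.NavierStokesRegularity.Theorems.AxisymmetricKatoGlobal.EulerScaling

open Literature.Analysis.FluidPDE Literature.Analysis.FluidPDE.Seregin2020

/-! ### Two measure-theoretic tools -/

/-- **«a.e. on an open cylinder ⇒ a.e. on every time slice up to the top».** If `Φ` is
continuous off a closed set `S` of axis points (for negative times) and `c ≤ Φ` a.e. on the open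
cylinder `]a, b[ × B(ρ)`, `b ≤ 0`... then for every `t ∈ ]a, b]` with `t < 0`, `c ≤ Φ(t, x)` for
a.e. `x ∈ B(ρ)`: off the axis the vertical line through `x` misses `S`, so `Φ(·, x)` is
continuous at `t` from below, where `Φ ≥ c` holds pointwise off `S`
(`SereginSverak2009.forall_le_of_ae_le_of_continuousOn`); the axis is Lebesgue-null. This
replaces the Lipschitz continuity of N–U's supersolutions. [folklore] -/
theorem ae_ball_le_of_ae_cylinder_le {Φ : ℝ → EuclideanSpace ℝ (Fin 3) → ℝ}
    {S : Set (ℝ × EuclideanSpace ℝ (Fin 3))} (hS : IsClosed S)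
    (hSax : ∀ z ∈ S, cylRadius z.2 = 0)
    (hcont : ContinuousOn (uncurry Φ) ({z : ℝ × EuclideanSpace ℝ (Fin 3) | z.1 < 0} \ S))
    {a b ρ c : ℝ} (hb : b ≤ 0)
    (h : ∀ᵐ z ∂(volume.restrict (Ioo a b ×ˢ ball (0 : EuclideanSpace ℝ (Fin 3)) ρ)), c ≤ Φ z.1 z.2) :
    ∀ t ∈ Ioc a b, t < 0 →
      ∀ᵐ x ∂(volume.restrict (ball (0 : EuclideanSpace ℝ (Fin 3)) ρ)), c ≤ Φ t x := by
  intro t ht ht0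
  -- the open set `W = (]a,b[ × B(ρ)) ∖ S`, on which `Φ ≥ c` everywhere
  set W : Set (ℝ × EuclideanSpace ℝ (Fin 3)) :=
    (Ioo a b ×ˢ ball (0 : EuclideanSpace ℝ (Fin 3)) ρ) \ S with hW
  have hWo : IsOpen W := (isOpen_Ioo.prod isOpen_ball).sdiff hS
  have hWsub : W ⊆ {z : ℝ × EuclideanSpace ℝ (Fin 3) | z.1 < 0} \ S := by
    rintro z ⟨⟨hz1, -⟩, hzS⟩
    exact ⟨lt_of_lt_of_le hz1.2 hb, hzS⟩
  have hWle : ∀ z ∈ W, c ≤ Φ z.1 z.2 := by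
    have h' : ∀ᵐ z ∂(volume.restrict W), (fun _ => c) z ≤ uncurry Φ z :=
      ae_restrict_of_ae_restrict_of_subset sdiff_subset h
    exact SereginSverak2009.forall_le_of_ae_le_of_continuousOn hWo continuousOn_const
      (hcont.mono hWsub) h'
  -- off the axis, approach `(t, x)` from below in time inside `W`
  have hpt : ∀ x ∈ ball (0 : EuclideanSpace ℝ (Fin 3)) ρ, cylRadius x ≠ 0 → c ≤ Φ t x := by
    intro x hx hxax
    have hnotS : ∀ s : ℝ, ((s, x) : ℝ × EuclideanSpace ℝ (Fin 3)) ∉ S :=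
      fun s hs => hxax (hSax _ hs)
    have hctx : ContinuousWithinAt (uncurry Φ) ({z : ℝ × EuclideanSpace ℝ (Fin 3) | z.1 < 0} \ S)
        (t, x) := hcont _ ⟨ht0, hnotS t⟩
    -- the curve `s ↦ (s, x)` for `s ↑ t`, `s ∈ ]a, t[`
    have hcurve : Tendsto (fun s : ℝ => ((s, x) : ℝ × EuclideanSpace ℝ (Fin 3))) (𝓝[<] t)
        (𝓝[{z : ℝ × EuclideanSpace ℝ (Fin 3) | z.1 < 0} \ S] (t, x)) := by
      refine tendsto_nhdsWithin_iff.2 ⟨?_, ?_⟩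
      · exact ((continuous_id.prodMk continuous_const).tendsto t).mono_left nhdsWithin_le_nhds
      · filter_upwards [self_mem_nhdsWithin] with s hs
        exact ⟨lt_trans hs ht0, hnotS s⟩
    have hlim : Tendsto (fun s : ℝ => Φ s x) (𝓝[<] t) (𝓝 (Φ t x)) := by
      exact hctx.tendsto.comp hcurve
    have hev : ∀ᶠ s in 𝓝[<] t, c ≤ Φ s x := by
      have hmem : Ioo a t ∈ 𝓝[<] t := Ioo_mem_nhdsLT ht.1
      filter_upwards [hmem] with s hs
      exact hWle (s, x) ⟨⟨⟨hs.1, lt_of_lt_of_le hs.2 ht.2⟩, hx⟩, hnotS s⟩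
    exact ge_of_tendsto hlim hev
  -- the axis is null
  have hnull : volume {x : EuclideanSpace ℝ (Fin 3) | cylRadius x = 0} = 0 :=
    volume_setOf_cylRadius_eq_zero
  rw [ae_restrict_iff' measurableSet_ball]
  have : ∀ᵐ x ∂(volume : Measure (EuclideanSpace ℝ (Fin 3))), cylRadius x ≠ 0 :=
    measure_eq_zero_iff_ae_notMem.1 hnull
  filter_upwards [this] with x hx hxb
  exact hpt x hxb hx

/-- **A space–time set of large measure has a large time slice** (Tonelli, contrapositive): if a
measurable `A ⊆ [a, b] × E` has `C · (b - a) < |A|`, then `C < |A_t|` for some `t ∈ ]a, b[`.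
Used to select N–U's time `t̄` from the space–time measure estimate (4.6). [folklore] -/
theorem exists_mem_Ioo_lt_volume_slice {A : Set (ℝ × EuclideanSpace ℝ (Fin 3))}
    (hA : MeasurableSet A) {a b : ℝ}
    (hAsub : A ⊆ Icc a b ×ˢ (univ : Set (EuclideanSpace ℝ (Fin 3)))) {C : ℝ≥0∞}
    (h : C * ENNReal.ofReal (b - a) < volume A) :
    ∃ t ∈ Ioo a b, C < volume (Prod.mk t ⁻¹' A) := by
  by_contra hcon
  push Not at hcon
  have hvol : volume A = ∫⁻ t, volume (Prod.mk t ⁻¹' A) ∂(volume : Measure ℝ) := by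
    rw [Measure.volume_eq_prod, Measure.prod_apply hA]
  -- the slice is empty outside `[a, b]`, and `≤ C` a.e. on it
  have hle : ∀ᵐ t ∂(volume : Measure ℝ),
      volume (Prod.mk t ⁻¹' A) ≤ (Icc a b).indicator (fun _ => C) t := by
    have hends : ∀ᵐ t ∂(volume : Measure ℝ), t ≠ a ∧ t ≠ b := by
      filter_upwards [(measure_eq_zero_iff_ae_notMem (μ := volume)).1 (Real.volume_singleton (a := a)),
        (measure_eq_zero_iff_ae_notMem (μ := volume)).1 (Real.volume_singleton (a := b))] with t h1 h2
      exact ⟨h1, h2⟩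
    filter_upwards [hends] with t ht
    by_cases htI : t ∈ Icc a b
    · rw [indicator_of_mem htI]
      have htO : t ∈ Ioo a b := ⟨lt_of_le_of_ne htI.1 (Ne.symm ht.1), lt_of_le_of_ne htI.2 ht.2⟩
      exact hcon t htO
    · rw [indicator_of_notMem htI]
      have : Prod.mk t ⁻¹' A = ∅ := by
        ext x
        simp only [mem_preimage, mem_empty_iff_false, iff_false]
        exact fun hx => htI (hAsub hx).1
      simp [this]
  have : volume A ≤ C * ENNReal.ofReal (b - a) := by
    calc volume A = ∫⁻ t, volume (Prod.mk t ⁻¹' A) ∂(volume : Measure ℝ) := hvol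
      _ ≤ ∫⁻ t, (Icc a b).indicator (fun _ => C) t ∂(volume : Measure ℝ) := lintegral_mono_ae hle
      _ = C * volume (Icc a b) := lintegral_indicator_const measurableSet_Icc C
      _ = C * ENNReal.ofReal (b - a) := by rw [Real.volume_Icc]
  exact absurd h (not_lt.2 this)

/-- From an a.e. lower bound on a ball to the density-`1` hypothesis of L3.2′:
`1 · |B(ρ)| ≤ |{x ∈ B(ρ) : κ ≤ Φ(t, x)}|`. [folklore] -/
theorem volume_ball_le_volume_superlevel {Φ : ℝ → EuclideanSpace ℝ (Fin 3) → ℝ} {t ρ κ : ℝ}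
    (h : ∀ᵐ x ∂(volume.restrict (ball (0 : EuclideanSpace ℝ (Fin 3)) ρ)), κ ≤ Φ t x) :
    ENNReal.ofReal 1 * volume (ball (0 : EuclideanSpace ℝ (Fin 3)) ρ) ≤
      volume {x : EuclideanSpace ℝ (Fin 3) | x ∈ ball (0 : EuclideanSpace ℝ (Fin 3)) ρ ∧ κ ≤ Φ t x} := by
  rw [ENNReal.ofReal_one, one_mul]
  have hbad : volume {x : EuclideanSpace ℝ (Fin 3) |
      x ∈ ball (0 : EuclideanSpace ℝ (Fin 3)) ρ ∧ ¬ κ ≤ Φ t x} = 0 := by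
    rw [ae_restrict_iff' measurableSet_ball] at h
    have h' := ae_iff.1 h
    simpa only [Classical.not_imp] using h'
  calc volume (ball (0 : EuclideanSpace ℝ (Fin 3)) ρ)
      ≤ volume ({x : EuclideanSpace ℝ (Fin 3) | x ∈ ball (0 : EuclideanSpace ℝ (Fin 3)) ρ ∧ κ ≤ Φ t x} ∪
          {x : EuclideanSpace ℝ (Fin 3) | x ∈ ball (0 : EuclideanSpace ℝ (Fin 3)) ρ ∧ ¬ κ ≤ Φ t x}) := by
        refine measure_mono fun x hx => ?_
        by_cases hκ : κ ≤ Φ t x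
        · exact Or.inl ⟨hx, hκ⟩
        · exact Or.inr ⟨hx, hκ⟩
    _ ≤ volume {x : EuclideanSpace ℝ (Fin 3) | x ∈ ball (0 : EuclideanSpace ℝ (Fin 3)) ρ ∧ κ ≤ Φ t x} +
          volume {x : EuclideanSpace ℝ (Fin 3) | x ∈ ball (0 : EuclideanSpace ℝ (Fin 3)) ρ ∧ ¬ κ ≤ Φ t x} :=
        measure_union_le _ _
    _ = volume {x : EuclideanSpace ℝ (Fin 3) | x ∈ ball (0 : EuclideanSpace ℝ (Fin 3)) ρ ∧ κ ≤ Φ t x} := by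
        rw [hbad, add_zero]


/-! ### One step of the chain (N–U Cor 3.2 (2)) -/

/-- **One step of Nazarov–Uraltseva's chain of cylinders (Cor 3.2 (2) with `δ = 1`, via
Lemmas 3.2, 3.3 and Cor 3.1 (2)/Remark 6), from the three analytic atoms.** The atoms are
hypotheses, already specialised to the data `Φ` at scale `R`, axis level `k` and to fixed
constants: `h32` = L3.2′ with `δ₀ = 1` (window constant `θ₀`); `h33` = L3.3′ with `λ = 2`,
`δ₁ = 1/3`, fraction `μ`, exponent `s`, windows `θ ∈ [θlo, θhi]`; `h31` = L3.1′ with fraction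
`μ₁ ≥ μ`, ratios `λ ∈ [λlo, 2]`, windows `[θlo, θhi]`. STEP: radii `r' < r ≤ R` with
`r/r' ∈ [λlo, 2]`, `R/4 ≤ r'`, a window `θr²` with `θ, 4θ ∈ [θlo, θhi]`, `θ ≤ θ₀`, bottom time
`t_b > -R²`, top `t_b + θr² ≤ 0`, a level `0 < κ ≤ k`: if `Φ(t_b, ·) ≥ κ` a.e. on `B(r)`, then
`Φ ≥ 2^{-(s+1)}κ/3` a.e. on `]t_b, t_b + θr²[ × B(r')`. Proof: density `1` at `t_b` ⇒ density
`1/3` of `{Φ ≥ κ/3}` on the whole window (L3.2′) ⇒ `{Φ < 2^{-s}κ/3}` has fraction `≤ μ ≤ μ₁` of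
`]t_b, t_b+θr²[ × B(r)` (L3.3′) ⇒ with the bottom bound `Φ(t_b,·) ≥ κ ≥ 2^{-s}κ/3` on `B(r)`,
L3.1′ (ii) on the cylinder of inner radius `r'`, outer radius `r = (r/r')·r'` gives the claim.
[cite: NazarovUraltseva2012, Cor 3.2 (2) and its proof] -/
theorem chain_step {Φ : ℝ → EuclideanSpace ℝ (Fin 3) → ℝ} {k R θ₀ μ μ₁ lamlo θlo θhi : ℝ} {s : ℕ}
    (h32 : ∀ (ρ θ t₀ κ : ℝ), R / 4 ≤ ρ → ρ ≤ 2 * R → 0 < θ → θ ≤ θ₀ →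
      t₀ ≤ 0 → -R ^ 2 < t₀ - θ * ρ ^ 2 → 0 < κ → κ ≤ k →
      ENNReal.ofReal 1 * volume (ball (0 : EuclideanSpace ℝ (Fin 3)) ρ)
        ≤ volume {x : EuclideanSpace ℝ (Fin 3) |
            x ∈ ball (0 : EuclideanSpace ℝ (Fin 3)) ρ ∧ κ ≤ Φ (t₀ - θ * ρ ^ 2) x} →
      ∀ t ∈ Icc (t₀ - θ * ρ ^ 2) t₀, t < 0 →
        ENNReal.ofReal (1 / 3) * volume (ball (0 : EuclideanSpace ℝ (Fin 3)) ρ)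
          ≤ volume {x : EuclideanSpace ℝ (Fin 3) |
              x ∈ ball (0 : EuclideanSpace ℝ (Fin 3)) ρ ∧ 1 * κ / 3 ≤ Φ t x})
    (h33 : ∀ (lam ρ θ t₀ κ₀ : ℝ), 2 ≤ lam → lam ≤ 2 → R / 4 ≤ ρ → lam * ρ ≤ 2 * R →
      θlo ≤ θ → θ ≤ θhi → t₀ ≤ 0 → -R ^ 2 < t₀ - θ * ρ ^ 2 → 0 < κ₀ → κ₀ ≤ k →
      (∀ᵐ t ∂(volume.restrict (Ioo (t₀ - θ * ρ ^ 2) t₀)),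
        ENNReal.ofReal (1 / 3) * volume (ball (0 : EuclideanSpace ℝ (Fin 3)) ρ)
          ≤ volume {x : EuclideanSpace ℝ (Fin 3) |
              x ∈ ball (0 : EuclideanSpace ℝ (Fin 3)) ρ ∧ κ₀ ≤ Φ t x}) →
      volume {z : ℝ × EuclideanSpace ℝ (Fin 3) |
          z ∈ Ioo (t₀ - θ * ρ ^ 2) t₀ ×ˢ ball (0 : EuclideanSpace ℝ (Fin 3)) ρ ∧
            Φ z.1 z.2 < (2 : ℝ)⁻¹ ^ s * κ₀}
        ≤ ENNReal.ofReal μ *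
          volume (Ioo (t₀ - θ * ρ ^ 2) t₀ ×ˢ ball (0 : EuclideanSpace ℝ (Fin 3)) ρ))
    (h31 : ∀ (lam ρ θ t₀ l : ℝ), lamlo ≤ lam → lam ≤ 2 → R / 4 ≤ ρ → lam * ρ ≤ 2 * R →
      θlo ≤ θ → θ ≤ θhi → t₀ ≤ 0 → -R ^ 2 < t₀ - θ * ρ ^ 2 → 0 < l → l ≤ k →
      volume {z : ℝ × EuclideanSpace ℝ (Fin 3) |
          z ∈ Ioo (t₀ - θ * ρ ^ 2) t₀ ×ˢ ball (0 : EuclideanSpace ℝ (Fin 3)) (lam * ρ) ∧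
            Φ z.1 z.2 < l}
        ≤ ENNReal.ofReal μ₁ *
          volume (Ioo (t₀ - θ * ρ ^ 2) t₀ ×ˢ ball (0 : EuclideanSpace ℝ (Fin 3)) (lam * ρ)) →
      (∀ᵐ z ∂(volume.restrict (Ioo (t₀ - θ / 2 * ρ ^ 2) t₀ ×ˢ
          ball (0 : EuclideanSpace ℝ (Fin 3)) ρ)), l / 2 ≤ Φ z.1 z.2) ∧
      ((∀ᵐ x ∂(volume.restrict (ball (0 : EuclideanSpace ℝ (Fin 3)) (lam * ρ))),
          l ≤ Φ (t₀ - θ * ρ ^ 2) x) →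
        ∀ᵐ z ∂(volume.restrict (Ioo (t₀ - θ * ρ ^ 2) t₀ ×ˢ
          ball (0 : EuclideanSpace ℝ (Fin 3)) ρ)), l / 2 ≤ Φ z.1 z.2))
    (hμ : μ ≤ μ₁)
    {r r' θ tb κ : ℝ} (hRr' : R / 4 ≤ r') (hr'0 : 0 < r') (hrr' : r' < r) (hrR : r ≤ R)
    (hlam : lamlo ≤ r / r') (hlam2 : r / r' ≤ 2)
    (hθlo : θlo ≤ θ) (hθ0 : 0 < θ) (hθθ₀ : θ ≤ θ₀) (hθhi : 4 * θ ≤ θhi)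
    (htb : -R ^ 2 < tb) (htop : tb + θ * r ^ 2 ≤ 0) (hκ : 0 < κ) (hκk : κ ≤ k)
    (hslice : ∀ᵐ x ∂(volume.restrict (ball (0 : EuclideanSpace ℝ (Fin 3)) r)), κ ≤ Φ tb x) :
    ∀ᵐ z ∂(volume.restrict (Ioo tb (tb + θ * r ^ 2) ×ˢ ball (0 : EuclideanSpace ℝ (Fin 3)) r')),
      (2 : ℝ)⁻¹ ^ (s + 1) / 3 * κ ≤ Φ z.1 z.2 := by
  set t₀ : ℝ := tb + θ * r ^ 2 with ht₀
  have e0 : t₀ - θ * r ^ 2 = tb := by rw [ht₀]; ring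
  have hr0 : 0 < r := hr'0.trans hrr'
  have hRr : R / 4 ≤ r := hRr'.trans hrr'.le
  -- (1) L3.2′ with `δ₀ = 1`: density `1/3` of `{Φ ≥ κ/3}` in `B(r)` on the whole window
  have h1 : ∀ t ∈ Icc tb t₀, t < 0 →
      ENNReal.ofReal (1 / 3) * volume (ball (0 : EuclideanSpace ℝ (Fin 3)) r)
        ≤ volume {x : EuclideanSpace ℝ (Fin 3) |
            x ∈ ball (0 : EuclideanSpace ℝ (Fin 3)) r ∧ κ / 3 ≤ Φ t x} := by
    have h := h32 r θ t₀ κ hRr (by linarith) hθ0 hθθ₀ htop (by rw [e0]; exact htb) hκ hκk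
      (by rw [e0]; exact volume_ball_le_volume_superlevel hslice)
    rw [e0] at h
    intro t ht ht0
    simpa only [one_mul] using h t ht ht0
  -- (2) L3.3′ with `λ = 2`, `δ₁ = 1/3`, `κ₀ = κ/3`
  have h2 : volume {z : ℝ × EuclideanSpace ℝ (Fin 3) |
      z ∈ Ioo tb t₀ ×ˢ ball (0 : EuclideanSpace ℝ (Fin 3)) r ∧ Φ z.1 z.2 < (2 : ℝ)⁻¹ ^ s * (κ / 3)}
        ≤ ENNReal.ofReal μ * volume (Ioo tb t₀ ×ˢ ball (0 : EuclideanSpace ℝ (Fin 3)) r) := by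
    have h := h33 2 r θ t₀ (κ / 3) le_rfl le_rfl hRr (by linarith) hθlo (by linarith) htop
      (by rw [e0]; exact htb) (by positivity) (by linarith)
    rw [e0] at h
    refine h ?_
    rw [ae_restrict_iff' measurableSet_Ioo]
    exact ae_of_all _ fun t ht => h1 t ⟨ht.1.le, ht.2.le⟩ (lt_of_lt_of_le ht.2 htop)
  -- (3) L3.1′ (ii) on the cylinder of inner radius `r'`, outer radius `r = (r/r') r'`
  have e1 : r / r' * r' = r := div_mul_cancel₀ r hr'0.ne'
  have e2 : t₀ - θ * (r / r') ^ 2 * r' ^ 2 = tb := by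
    rw [← e0, div_pow]
    field_simp
  have hl0 : 0 < (2 : ℝ)⁻¹ ^ s * (κ / 3) := by positivity
  have hl1 : (2 : ℝ)⁻¹ ^ s * (κ / 3) ≤ κ := by
    have hp : (2 : ℝ)⁻¹ ^ s ≤ 1 := pow_le_one₀ (by norm_num) (by norm_num)
    nlinarith
  have hθ' : θlo ≤ θ * (r / r') ^ 2 ∧ θ * (r / r') ^ 2 ≤ θhi := by
    have hge : 1 ≤ (r / r') ^ 2 := by
      have : 1 ≤ r / r' := by rw [le_div_iff₀ hr'0]; linarith
      nlinarith
    have hle : (r / r') ^ 2 ≤ 4 := by nlinarith [div_pos hr0 hr'0]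
    constructor <;> nlinarith
  have h := h31 (r / r') r' (θ * (r / r') ^ 2) t₀ ((2 : ℝ)⁻¹ ^ s * (κ / 3)) hlam hlam2 hRr'
  rw [e1, e2] at h
  have h3 := (h (by linarith) hθ'.1 hθ'.2 htop htb hl0 (hl1.trans hκk)
    (h2.trans (by gcongr))).2
    (by filter_upwards [hslice] with x hx; exact hl1.trans hx)
  filter_upwards [h3] with z hz
  calc (2 : ℝ)⁻¹ ^ (s + 1) / 3 * κ = (2 : ℝ)⁻¹ ^ s * (κ / 3) / 2 := by ring
    _ ≤ Φ z.1 z.2 := hz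

end Summit.NavierStokesRegularity.NavierStokesRegularity.Theorems.AxisymmetricKatoGlobal.EulerScaling

end
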